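import Summits.ValiantsHypothesis.ValiantsHypothesis.Theorems.SymPencilPerFourBlockPointLemma
import Summits.ValiantsHypothesis.ValiantsHypothesis.Theorems.SymPencilSingSixClassificationZeroLine
import Summits.ValiantsHypothesis.ValiantsHypothesis.Theorems.SymPencilPerFourTwoRowCorankTwo

/-!
# Route `SymPencil` — the V-side of the size-27 cell `(11, 5, 4)`, PORT of val-idea-18's cascade, leaf R1C (reduction + leaf)
# (`--supports` stmt-ValiantsHypothesis-5674 `SdcSuperquadratic`; port of §2d of
# `Cruxes/SdcSuperquadratic/Lines/sing_five_classification.lean` rev 10 (val-idea-18 g5) with `Sing3At` / `FamAt` / `PointConcl`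
# unfolded; PORT-PLAN-115.md; rung currency only)

Leaf R1C of the cascade (memo §6.1): a `5`-dimensional singular `W` with exactly one zero row and one zero column, not in a cross,
carrying a per-direction family of `≤ 4` squares at every element — impossible.  `blockPoint_of_33` (normalisation of the point
lemma to zero row `3` / zero column `3` by `prodCongr`), `threeByThree_of_point` (the union step over the `3 + 3 + 16` proper
subspaces «second zero row / second zero column / cross support», ✓ `Submodule.exists_forall_notMem_of_forall_ne_top`), and
`threeByThree` = the workfile's `stub_threeByThree`, with the point lemma supplied by ✓ `SymPencilPerFourBlockPointLemma.blockPoint33`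
(p642467) instead of the workfile's §2e–2g.

Honest framing: [folklore] a port; `27 ≤ sdc(per₄) ≤ 29` unchanged; the crux `SdcSuperquadratic` and `VP ≠ VNP` untouched; no summit
statement is proved here.  No definitions, no named facts.
-/

noncomputable section

-- single-conjunct layout: Sub = Summit, duplicated namespace component intended
set_option linter.dupNamespace false

namespace Summit.ValiantsHypothesis.ValiantsHypothesis.Theorems.SymPencilSingFiveClassification

open MvPolynomial Module Matrix
open Literature.Computability.AlgebraicComplexity
open Summit.ValiantsHypothesis.ValiantsHypothesis.Theorems
open Summit.ValiantsHypothesis.ValiantsHypothesis.Theorems.SymPencilSingSixClassification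

variable {K : Type*} [Field K]

/-- **Normalisation of the point lemma**: it suffices to treat zero row `3` and zero column `3`
(relabel rows and columns by transpositions; `per₄` is invariant, ✓ `eval_perPoly_comp_prodCongr`,
and the family moves by ✓ `sum_sq_swap_map`). [folklore] -/
theorem blockPoint_of_33
    (h33 : ∀ y : Fin 4 × Fin 4 → K, (∀ m, y (3, m) = 0) → (∀ m, y (m, 3) = 0) →
      (∀ (r c : Fin 3 → Fin 4), Function.Injective r → Function.Injective c →
      ((Matrix.of fun a b => y (a, b)).submatrix r c).permanent = 0) →
      (∃ (c : Fin 4 → K) (Λ : Fin 4 → ((Fin 4 × Fin 4 → K) →ₗ[K] K)),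
      ∀ u : Fin 4 × Fin 4 → K, ∃ e₀ e₁ : K, ∀ s : K,
        eval (u + s • y) (perPoly (Fin 4) K) = e₀ + s * e₁ + s ^ 2 * ∑ k, c k * (Λ k u) ^ 2) →
      ((∃ i', i' ≠ 3 ∧ ∀ m, y (i', m) = 0) ∨ (∃ j', j' ≠ 3 ∧ ∀ m, y (m, j') = 0) ∨
      (∃ l c : Fin 4, ∀ a b : Fin 4, a ≠ l → b ≠ c → y (a, b) = 0)))
    (i j : Fin 4) (y : Fin 4 × Fin 4 → K) (hrow : ∀ m, y (i, m) = 0) (hcol : ∀ m, y (m, j) = 0)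
    (hS : (∀ (r c : Fin 3 → Fin 4), Function.Injective r → Function.Injective c →
      ((Matrix.of fun a b => y (a, b)).submatrix r c).permanent = 0))
    (hF : (∃ (c : Fin 4 → K) (Λ : Fin 4 → ((Fin 4 × Fin 4 → K) →ₗ[K] K)),
      ∀ u : Fin 4 × Fin 4 → K, ∃ e₀ e₁ : K, ∀ s : K,
        eval (u + s • y) (perPoly (Fin 4) K) = e₀ + s * e₁ + s ^ 2 * ∑ k, c k * (Λ k u) ^ 2)) :
    ((∃ i', i' ≠ i ∧ ∀ m, y (i', m) = 0) ∨ (∃ j', j' ≠ j ∧ ∀ m, y (m, j') = 0) ∨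
      (∃ l c : Fin 4, ∀ a b : Fin 4, a ≠ l → b ≠ c → y (a, b) = 0)) := by
  classical
  set σ : Equiv.Perm (Fin 4) := Equiv.swap 3 i with hσ
  set τ : Equiv.Perm (Fin 4) := Equiv.swap 3 j with hτ
  have hσ3 : σ 3 = i := by rw [hσ, Equiv.swap_apply_left]
  have hτ3 : τ 3 = j := by rw [hτ, Equiv.swap_apply_left]
  set Φ : (Fin 4 × Fin 4 → K) ≃ₗ[K] (Fin 4 × Fin 4 → K) :=
    LinearEquiv.funCongrLeft K K (Equiv.prodCongr σ τ) with hΦ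
  have hΦa : ∀ (x : Fin 4 × Fin 4 → K) (a b : Fin 4), Φ x (a, b) = x (σ a, τ b) := fun x a b => rfl
  have hrow' : ∀ m, Φ y (3, m) = 0 := fun m => by rw [hΦa, hσ3]; exact hrow _
  have hcol' : ∀ m, Φ y (m, 3) = 0 := fun m => by rw [hΦa, hτ3]; exact hcol _
  have hS' : (∀ (r c : Fin 3 → Fin 4), Function.Injective r → Function.Injective c →
      ((Matrix.of fun a b => Φ y (a, b)).submatrix r c).permanent = 0) := by
    intro r c hr hc
    have hm : (Matrix.of fun a b => Φ y (a, b)).submatrix r c =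
        (Matrix.of fun a b => y (a, b)).submatrix (σ ∘ r) (τ ∘ c) := by
      ext a b; rfl
    rw [hm]
    exact hS _ _ (σ.injective.comp hr) (τ.injective.comp hc)
  have hF' : (∃ (c : Fin 4 → K) (Λ : Fin 4 → ((Fin 4 × Fin 4 → K) →ₗ[K] K)),
      ∀ u : Fin 4 × Fin 4 → K, ∃ e₀ e₁ : K, ∀ s : K,
        eval (u + s • Φ y) (perPoly (Fin 4) K) = e₀ + s * e₁ + s ^ 2 * ∑ k, c k * (Λ k u) ^ 2) := by
    obtain ⟨c, Λ, h⟩ := hF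
    exact ⟨c, fun k => (Λ k).comp Φ.symm.toLinearMap,
      SymPencilPerFourTwoRowCorankTwo.sum_sq_swap_map Φ
        (fun z => SymPencilPerFourBlocks.eval_perPoly_comp_prodCongr σ τ z) y c Λ h⟩
  have hback : ∀ a b : Fin 4, y (a, b) = Φ y (σ.symm a, τ.symm b) := fun a b => by
    rw [hΦa, Equiv.apply_symm_apply, Equiv.apply_symm_apply]
  rcases h33 (Φ y) hrow' hcol' hS' hF' with ⟨i', hi', h⟩ | ⟨j', hj', h⟩ | ⟨l, c, h⟩
  · refine Or.inl ⟨σ i', fun he => hi' (σ.injective (he.trans hσ3.symm)), fun m => ?_⟩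
    rw [hback, Equiv.symm_apply_apply]
    exact h _
  · refine Or.inr (Or.inl ⟨τ j', fun he => hj' (τ.injective (he.trans hτ3.symm)), fun m => ?_⟩)
    rw [hback, Equiv.symm_apply_apply]
    exact h _
  · refine Or.inr (Or.inr ⟨σ l, τ c, fun a b ha hb => ?_⟩)
    rw [hback]
    refine h _ _ (fun he => ha ?_) (fun he => hb ?_)
    · rw [← he, Equiv.apply_symm_apply]
    · rw [← he, Equiv.apply_symm_apply]

/-- **Leaf R1C from its point lemma** (the union step (I6)): if every element of `W` with the
per-direction family has a second zero row, a second zero column or cross support … (memo). [folklore] -/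
theorem threeByThree_of_point [CharZero K]
    (hpt : ∀ (i j : Fin 4) (y : Fin 4 × Fin 4 → K), (∀ m, y (i, m) = 0) → (∀ m, y (m, j) = 0) →
      (∀ (r c : Fin 3 → Fin 4), Function.Injective r → Function.Injective c →
      ((Matrix.of fun a b => y (a, b)).submatrix r c).permanent = 0) →
      (∃ (c : Fin 4 → K) (Λ : Fin 4 → ((Fin 4 × Fin 4 → K) →ₗ[K] K)),
      ∀ u : Fin 4 × Fin 4 → K, ∃ e₀ e₁ : K, ∀ s : K,
        eval (u + s • y) (perPoly (Fin 4) K) = e₀ + s * e₁ + s ^ 2 * ∑ k, c k * (Λ k u) ^ 2) →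
      ((∃ i', i' ≠ i ∧ ∀ m, y (i', m) = 0) ∨ (∃ j', j' ≠ j ∧ ∀ m, y (m, j') = 0) ∨
      (∃ l c : Fin 4, ∀ a b : Fin 4, a ≠ l → b ≠ c → y (a, b) = 0)))
    (W : Submodule K (Fin 4 × Fin 4 → K)) (hS : Sing3 W)
    (hi : ∃ i : Fin 4, ∀ x ∈ W, ∀ j : Fin 4, x (i, j) = 0)
    (hj : ∃ j : Fin 4, ∀ x ∈ W, ∀ i : Fin 4, x (i, j) = 0)
    (h2r : ¬ TwoZeroRows W) (h2c : ¬ TwoZeroCols W) (hX : ¬ InCross W)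
    (hP : ∀ y ∈ W, ∃ (c : Fin 4 → K) (Λ : Fin 4 → ((Fin 4 × Fin 4 → K) →ₗ[K] K)),
      ∀ u : Fin 4 × Fin 4 → K, ∃ e₀ e₁ : K, ∀ s : K,
        eval (u + s • y) (perPoly (Fin 4) K) = e₀ + s * e₁ + s ^ 2 * ∑ k, c k * (Λ k u) ^ 2) :
    False := by
  classical
  obtain ⟨i, hi⟩ := hi
  obtain ⟨j, hj⟩ := hj
  let rowS : Fin 4 → Submodule K (Fin 4 × Fin 4 → K) := fun i' =>
    ⨅ m : Fin 4, LinearMap.ker (LinearMap.proj (i', m) : (Fin 4 × Fin 4 → K) →ₗ[K] K)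
  let colS : Fin 4 → Submodule K (Fin 4 × Fin 4 → K) := fun j' =>
    ⨅ m : Fin 4, LinearMap.ker (LinearMap.proj (m, j') : (Fin 4 × Fin 4 → K) →ₗ[K] K)
  let crossS : Fin 4 × Fin 4 → Submodule K (Fin 4 × Fin 4 → K) := fun lc =>
    ⨅ (a : Fin 4) (b : Fin 4) (_ : a ≠ lc.1) (_ : b ≠ lc.2),
      LinearMap.ker (LinearMap.proj (a, b) : (Fin 4 × Fin 4 → K) →ₗ[K] K)
  have mem_rowS : ∀ i' x, x ∈ rowS i' ↔ ∀ m, x (i', m) = 0 := fun i' x => by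
    simp [rowS, Submodule.mem_iInf]
  have mem_colS : ∀ j' x, x ∈ colS j' ↔ ∀ m, x (m, j') = 0 := fun j' x => by
    simp [colS, Submodule.mem_iInf]
  have mem_crossS : ∀ lc x, x ∈ crossS lc ↔ ∀ a b, a ≠ lc.1 → b ≠ lc.2 → x (a, b) = 0 :=
    fun lc x => by simp [crossS, Submodule.mem_iInf]
  let S : ({i' : Fin 4 // i' ≠ i} ⊕ {j' : Fin 4 // j' ≠ j} ⊕ (Fin 4 × Fin 4)) →
      Submodule K (Fin 4 × Fin 4 → K) :=
    Sum.elim (fun i' => rowS i') (Sum.elim (fun j' => colS j') crossS)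
  let p : ({i' : Fin 4 // i' ≠ i} ⊕ {j' : Fin 4 // j' ≠ j} ⊕ (Fin 4 × Fin 4)) → Submodule K ↥W :=
    fun k => (S k).comap W.subtype
  have hne : ∀ k, p k ≠ ⊤ := by
    intro k hk
    have hle : W ≤ S k := Submodule.comap_subtype_eq_top.1 hk
    rcases k with ⟨i', hi'⟩ | ⟨j', hj'⟩ | ⟨l, c⟩
    · refine h2r ⟨i, i', Ne.symm hi', fun x hx m => ⟨hi x hx m, ?_⟩⟩
      have hx' : x ∈ rowS i' := hle hx
      exact (mem_rowS i' x).1 hx' m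
    · refine h2c ⟨j, j', Ne.symm hj', fun x hx m => ⟨hj x hx m, ?_⟩⟩
      have hx' : x ∈ colS j' := hle hx
      exact (mem_colS j' x).1 hx' m
    · refine hX ⟨l, c, fun x hx a b ha hb => ?_⟩
      have hx' : x ∈ crossS (l, c) := hle hx
      exact (mem_crossS (l, c) x).1 hx' a b ha hb
  obtain ⟨x, hx⟩ := Submodule.exists_forall_notMem_of_forall_ne_top p hne
  obtain ⟨c, Λ, hfam⟩ := hP x x.2
  rcases hpt i j x (hi x x.2) (hj x x.2) (hS x x.2) ⟨c, Λ, hfam⟩ with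
    ⟨i', hi', hrow⟩ | ⟨j', hj', hcol⟩ | ⟨l, c', hcr⟩
  · exact hx (Sum.inl ⟨i', hi'⟩) (by
      change (x : Fin 4 × Fin 4 → K) ∈ rowS i'
      exact (mem_rowS i' x).2 hrow)
  · exact hx (Sum.inr (Sum.inl ⟨j', hj'⟩)) (by
      change (x : Fin 4 × Fin 4 → K) ∈ colS j'
      exact (mem_colS j' x).2 hcol)
  · exact hx (Sum.inr (Sum.inr (l, c'))) (by
      change (x : Fin 4 × Fin 4 → K) ∈ crossS (l, c')
      exact (mem_crossS (l, c') x).2 hcr)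


/-- **Leaf R1C** (the workfile's `stub_threeByThree` with `PerDirFour` unfolded): one zero row and one zero column, no second
zero row / column, not in a cross — impossible under a per-direction family of `≤ 4` squares at every element; the union
step `threeByThree_of_point` over the point lemma ✓ `SymPencilPerFourBlockPointLemma.blockPoint33` transported by
`blockPoint_of_33`. [folklore] -/
theorem threeByThree [CharZero K] :
    ∀ W : Submodule K (Fin 4 × Fin 4 → K), Sing3 W → finrank K W = 5 →
      (∃ i : Fin 4, ∀ x ∈ W, ∀ j : Fin 4, x (i, j) = 0) →
      (∃ j : Fin 4, ∀ x ∈ W, ∀ i : Fin 4, x (i, j) = 0) →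
      ¬ TwoZeroRows W → ¬ TwoZeroCols W → ¬ InCross W →
      (∀ y ∈ W, ∃ (c : Fin 4 → K) (Λ : Fin 4 → ((Fin 4 × Fin 4 → K) →ₗ[K] K)),
        ∀ u : Fin 4 × Fin 4 → K, ∃ e₀ e₁ : K, ∀ s : K,
          eval (u + s • y) (perPoly (Fin 4) K) = e₀ + s * e₁ + s ^ 2 * ∑ k, c k * (Λ k u) ^ 2) → False := by
  intro W hS _h5 hi hj h2r h2c hX hP
  exact threeByThree_of_point (blockPoint_of_33 SymPencilPerFourBlockPointLemma.blockPoint33) W hS hi hj h2r h2c hX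
    (fun y hy => hP y hy)

end Summit.ValiantsHypothesis.ValiantsHypothesis.Theorems.SymPencilSingFiveClassification
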